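import Mathlib
import HarnessLib

/-!
# LINE (A) `product_plus_one` — the θ-tower of a K-nomial row `A − Σ_l B_l x^{λ_l}` (definitions only; every support size)

Crux item stmt-ValiantsHypothesis-18050, LINE (A) W-cells (owner memo `pub/ideators/val-idea-25/NOTE-idea25g3-18050-LINEA-AB-reduction.md` §19–§24).  The K = 3
closed forms of ✓ `…CloudDefs` (`rowH e₁ e₂ k`, `rowU`, `rowPsi0…3` for the row `A − Bx^p − Cx^q`) written for a tail with ANY number `n` of letters and arbitrary
natural rates `λ : Fin n → ℕ`: the stripped row is `A − h(x)`, `h(x) = Σ_l B_l x^{λ_l}`, `θ = x·d/dx`, and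

* `rowHK λ k B x = Σ_l λ_l^k · B_l · x^{λ_l}` (`= θ^k h`);  `rowUK λ A B x = (A − Σ_l B_l x^{λ_l})⁻¹`;
* `rowPsiK0 = H₁u` (minus the stripped Euler ratio), `rowPsiK1 = H₂u + H₁²u²` (`θψ₀`; the row's log-Wronskian is `W(f)(x) = −f(x)²·rowPsiK1`),
  `rowPsiK2 = H₃u + 3H₁H₂u² + 2H₁³u³` (`θ²ψ₀`), `rowPsiK3 = H₄u + (4H₁H₃ + 3H₂²)u² + 12H₁²H₂u³ + 6H₁⁴u⁴` (`θ³ψ₀`)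

— the SAME polynomials in `(H₁,…,H₄,u)` as at K = 3 (the tower uses only `θ(A − h) = −H₁`, `θH_k = H_{k+1}`, `θu = H₁u²`).  Plain `noncomputable def`s of real
numbers; no structure / instance / notation / axiom.  That these ARE the θ-derivatives, the rate laws `ψ₃ − λ²ψ₁ = 6ψ₁²` (one letter) and `p²ψ₁ ≤ ψ₃` (all rates `≥ p`,
`B ≥ 0`, `u > 0`), and the every-K rate-free W-cell are proved in the companion files.  Honest framing: definitions only; nothing closes; `OneChangeFloorK3` /
`WronskianBudgetK3` / 18050 / `MatrixDescartes` OPEN; `VP ≠ VNP` NOT proved.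
-/

set_option linter.dupNamespace false

namespace Summit.ValiantsHypothesis.ValiantsHypothesis.Theorems.LacunarySymmetroidMatrixDescartes

namespace ProductPlusOne

open Finset
open scoped BigOperators

variable {n : ℕ}

/-- `θ^k h` for the tail `h(x) = Σ_l B_l x^{λ_l}`: `rowHK λ k B x = Σ_l λ_l^k · B_l · x^{λ_l}`. -/
noncomputable def rowHK (lam : Fin n → ℕ) (k : ℕ) (B : Fin n → ℝ) (x : ℝ) : ℝ :=
  ∑ l, ((lam l : ℕ) : ℝ) ^ k * B l * x ^ (lam l)

/-- `u = (A − Σ_l B_l x^{λ_l})⁻¹`, the inverse of the stripped row. -/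
noncomputable def rowUK (lam : Fin n → ℕ) (A : ℝ) (B : Fin n → ℝ) (x : ℝ) : ℝ :=
  (A - ∑ l, B l * x ^ (lam l))⁻¹

/-- `ψ₀ = H₁u` (minus the stripped Euler ratio of the row). -/
noncomputable def rowPsiK0 (lam : Fin n → ℕ) (A : ℝ) (B : Fin n → ℝ) (x : ℝ) : ℝ :=
  rowHK lam 1 B x * rowUK lam A B x

/-- `ψ₁ = θψ₀ = H₂u + H₁²u²` (the row's slope; `W(f)(x) = −f(x)²·ψ₁`). -/
noncomputable def rowPsiK1 (lam : Fin n → ℕ) (A : ℝ) (B : Fin n → ℝ) (x : ℝ) : ℝ :=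
  rowHK lam 2 B x * rowUK lam A B x + rowHK lam 1 B x ^ 2 * rowUK lam A B x ^ 2

/-- `ψ₂ = θ²ψ₀ = H₃u + 3H₁H₂u² + 2H₁³u³`. -/
noncomputable def rowPsiK2 (lam : Fin n → ℕ) (A : ℝ) (B : Fin n → ℝ) (x : ℝ) : ℝ :=
  rowHK lam 3 B x * rowUK lam A B x + 3 * rowHK lam 1 B x * rowHK lam 2 B x * rowUK lam A B x ^ 2
    + 2 * rowHK lam 1 B x ^ 3 * rowUK lam A B x ^ 3

/-- `ψ₃ = θ³ψ₀ = H₄u + (4H₁H₃ + 3H₂²)u² + 12H₁²H₂u³ + 6H₁⁴u⁴`. -/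
noncomputable def rowPsiK3 (lam : Fin n → ℕ) (A : ℝ) (B : Fin n → ℝ) (x : ℝ) : ℝ :=
  rowHK lam 4 B x * rowUK lam A B x
    + (4 * rowHK lam 1 B x * rowHK lam 3 B x + 3 * rowHK lam 2 B x ^ 2) * rowUK lam A B x ^ 2
    + 12 * rowHK lam 1 B x ^ 2 * rowHK lam 2 B x * rowUK lam A B x ^ 3
    + 6 * rowHK lam 1 B x ^ 4 * rowUK lam A B x ^ 4

end ProductPlusOne

end Summit.ValiantsHypothesis.ValiantsHypothesis.Theorems.LacunarySymmetroidMatrixDescartes
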